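import Literature.Computability.Complexity.CNF
import Literature.Computability.MetaComplexity.Xorification
import HarnessLib

/-!
# Gadget composition `F ∘ gⁿ` of a CNF expanded to CNF, and the inner-product lift `F ∘ IP_ℓⁿ`

Trunk T-CPLX-META (proof complexity / lifting). Lifting theorems compose an unsatisfiable CNF
`F(z₁,…,z_n)` with a two-party or multi-bit *gadget* `g : {0,1}^a → {0,1}`, substituting
`zᵢ := g(block i)` on disjoint blocks of `a` fresh variables and re-expanding every clause into
CNF (Garg–Göös–Kamath–Sokolov, *Monotone circuit lower bounds from resolution*, STOC 2018, §2–3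
("`F ∘ gⁿ` … we identify the composed formula with its natural CNF encoding"); Rao–Yehudayoff,
*Communication Complexity*, 2020, Ch. 8 (lifting with the index and inner-product gadgets);
for `g = ⊕_ℓ` this is Bonacina's `ℓ`-xorification, `Xorification.lean`). The block of the
variable `x` is `x·a, …, x·a + (a-1)` (= `xorBlock a x`).

Provided here (all PROVED, no named facts):
* `gadgetLiteralCNF a g l`, `gadgetLiftClause a g c`, `gadgetLift a g φ` — the canonical CNF of
  `g(block x) = b`, the distributed clause, the lifted CNF; `gadgetAssignment a g σ` — the induced
  assignment `x ↦ g(σ|block x)`;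
* semantics `eval_gadgetLift : (gadgetLift a g φ).eval σ = φ.eval (gadgetAssignment a g σ)`,
  `gadgetLift_not_satisfiable`, width `isWidthLE_gadgetLift` (`k`-CNF ↦ `ka`-CNF) and
  `numVars_gadgetLift_le` (`≤ a · numVars φ`);
* the inner-product gadget `ipGadget ℓ : (Fin (2ℓ) → Bool) → Bool`,
  `IP_ℓ(u) = ⊕_{j<ℓ} (u_{2j} ∧ u_{2j+1})`, and `ipLift ℓ := gadgetLift (2ℓ) (ipGadget ℓ)`
  (Kushilevitz–Nisan 1996, Example 1.26; the gadget of IP-lifting).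
-/

namespace Literature.Computability.MetaComplexity

open Literature.Computability.Complexity

/-! ### Generic gadget composition -/

/-- The assignment of a block read off a list `S` of variables deemed true:
`j ↦ [x·a + j ∈ S]`. [cite: GargEtAl2018, §2] -/
def blockIndicator (a x : ℕ) (S : List ℕ) : Fin a → Bool :=
  fun j => decide (x * a + j ∈ S)

/-- The assignment of the block of `x` under `σ`: `j ↦ σ(x·a + j)`. [cite: GargEtAl2018, §2] -/
def blockRestrict (a : ℕ) (σ : ℕ → Bool) (x : ℕ) : Fin a → Bool :=
  fun j => σ (x * a + j)

/-- The canonical CNF of the constraint `g(block x) = b` replacing the literal `x^b`: for every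
sub-list `S` of the block with `g(𝟙_S) ≠ b`, the clause `⋁_{v ∈ block} v^{[v ∉ S]}`, falsified
exactly by the block assignment `𝟙_S`. [cite: GargEtAl2018, §2 (CNF encoding of F ∘ gⁿ)] -/
def gadgetLiteralCNF (a : ℕ) (g : (Fin a → Bool) → Bool) (l : Literal ℕ) : CNF ℕ :=
  ((xorBlock a l.1).sublists.filter fun S => g (blockIndicator a l.1 S) ≠ l.2).map fun S =>
    (xorBlock a l.1).map fun v => (v, decide (v ∉ S))

/-- The lift of one clause `l₁ ∨ ⋯ ∨ l_k`: by distributivity, all clauses `D₁ ∨ ⋯ ∨ D_k` with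
`D_t` a clause of `gadgetLiteralCNF` of `l_t`; the empty clause goes to the empty clause.
[cite: GargEtAl2018, §2] -/
def gadgetLiftClause (a : ℕ) (g : (Fin a → Bool) → Bool) : Clause ℕ → CNF ℕ
  | [] => [[]]
  | l :: c => (gadgetLiteralCNF a g l).flatMap fun d => (gadgetLiftClause a g c).map fun e => d ++ e

/-- **The gadget composition `F ∘ gⁿ` as a CNF**: every variable `x` of `F` is replaced by
`g` applied to the block `x·a, …, x·a + a - 1` of fresh variables and the result is expanded into
CNF clause by clause. [cite: GargEtAl2018, §2] [cite: RaoYehudayoff2020, Ch. 8] -/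
def gadgetLift (a : ℕ) (g : (Fin a → Bool) → Bool) (φ : CNF ℕ) : CNF ℕ :=
  φ.flatMap (gadgetLiftClause a g)

/-- The assignment of the original variables induced by an assignment `σ` of the block
variables: `x ↦ g(σ|block x)`. [cite: GargEtAl2018, §2] -/
def gadgetAssignment (a : ℕ) (g : (Fin a → Bool) → Bool) (σ : ℕ → Bool) (x : ℕ) : Bool :=
  g (blockRestrict a σ x)

/-- The indicator of the set of block variables made true by `σ` is `σ` restricted to the block.
[folklore] -/
theorem blockIndicator_filter (a x : ℕ) (σ : ℕ → Bool) :
    blockIndicator a x ((xorBlock a x).filter fun v => σ v) = blockRestrict a σ x := by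
  funext j
  have hmem : x * a + (j : ℕ) ∈ xorBlock a x := mem_xorBlock.2 ⟨j, j.isLt, rfl⟩
  unfold blockIndicator blockRestrict
  by_cases h : σ (x * a + j) = true
  · simp [List.mem_filter, hmem, h]
  · simp [List.mem_filter, hmem, h]

/-- **Semantics of the literal CNF**: `gadgetLiteralCNF a g (x, b)` is true under `σ` iff
`g(σ|block x) = b`. [cite: GargEtAl2018, §2] -/
theorem eval_gadgetLiteralCNF (a : ℕ) (g : (Fin a → Bool) → Bool) (l : Literal ℕ) (σ : ℕ → Bool) :
    (gadgetLiteralCNF a g l).eval σ = l.eval (gadgetAssignment a g σ) := by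
  obtain ⟨x, b⟩ := l
  set T := (xorBlock a x).filter fun v => σ v with hT
  have key : (Literal.eval (gadgetAssignment a g σ) (x, b) = true) ↔ g (blockIndicator a x T) = b := by
    simp only [Literal.eval, gadgetAssignment, hT, blockIndicator_filter, beq_iff_eq]
  rw [Bool.eq_iff_iff, key, CNF.eval_eq_true_iff]
  constructor
  · intro h
    by_contra hne
    have hmem : ((xorBlock a x).map fun v => (v, decide (v ∉ T))) ∈ gadgetLiteralCNF a g (x, b) :=
      List.mem_map.2 ⟨T, List.mem_filter.2 ⟨List.mem_sublists.2 List.filter_sublist,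
        by simpa using hne⟩, rfl⟩
    have hfalse : ((xorBlock a x).map fun v => (v, decide (v ∉ T))).any (Literal.eval σ) =
        false := (any_blockClause_eq_false_iff σ).2 fun v hv => by
      by_cases hσ : σ v = true <;> simp [hT, List.mem_filter, hv, hσ]
    have := h _ hmem
    unfold Clause.eval at this
    rw [hfalse] at this
    exact Bool.false_ne_true this
  · intro h D hD
    obtain ⟨S, hS, rfl⟩ := List.mem_map.1 hD
    obtain ⟨hSsub, hSg⟩ := List.mem_filter.1 hS
    rw [List.mem_sublists] at hSsub
    by_contra hDfalse
    have hall : ∀ v ∈ xorBlock a x, σ v = decide (v ∈ S) :=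
      (any_blockClause_eq_false_iff σ).1 (by simpa [Clause.eval] using hDfalse)
    have hTS : T = S := by
      rw [hT, ← filter_mem_eq_of_sublist hSsub (nodup_xorBlock a x)]
      exact List.filter_congr fun v hv => by rw [hall v hv]
    rw [hTS] at h
    exact (by simpa using hSg : ¬ g (blockIndicator a x S) = b) h

/-- Semantics of the lift of a clause. [cite: GargEtAl2018, §2] -/
theorem eval_gadgetLiftClause (a : ℕ) (g : (Fin a → Bool) → Bool) (c : Clause ℕ) (σ : ℕ → Bool) :
    (gadgetLiftClause a g c).eval σ = c.eval (gadgetAssignment a g σ) := by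
  induction c with
  | nil => rfl
  | cons l c ih =>
    rw [gadgetLiftClause, eval_flatMap_map_append, eval_gadgetLiteralCNF, ih]
    rfl

/-- **Semantics of the gadget composition**: `F ∘ gⁿ` is true under `σ` iff `F` is true under
the induced assignment `x ↦ g(σ|block x)`. [cite: GargEtAl2018, §2] -/
theorem eval_gadgetLift (a : ℕ) (g : (Fin a → Bool) → Bool) (φ : CNF ℕ) (σ : ℕ → Bool) :
    (gadgetLift a g φ).eval σ = φ.eval (gadgetAssignment a g σ) := by
  rw [Bool.eq_iff_iff, CNF.eval_eq_true_iff, CNF.eval_eq_true_iff]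
  simp only [gadgetLift, List.mem_flatMap, forall_exists_index, and_imp]
  constructor
  · intro h c hc
    rw [← eval_gadgetLiftClause, CNF.eval_eq_true_iff]
    exact fun D hD => h D c hc hD
  · intro h D c hc hD
    exact (CNF.eval_eq_true_iff _ _).1 ((eval_gadgetLiftClause a g c σ).symm ▸ h c hc) D hD

/-- Gadget composition preserves unsatisfiability. [cite: GargEtAl2018, §2] -/
theorem gadgetLift_not_satisfiable {a : ℕ} {g : (Fin a → Bool) → Bool} {φ : CNF ℕ}
    (h : ¬ φ.Satisfiable) : ¬ (gadgetLift a g φ).Satisfiable := by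
  rintro ⟨σ, hσ⟩
  exact h ⟨gadgetAssignment a g σ, by rwa [← eval_gadgetLift]⟩

/-- Every clause of the literal CNF has exactly `a` literals. [folklore] -/
theorem length_of_mem_gadgetLiteralCNF {a : ℕ} {g : (Fin a → Bool) → Bool} {l : Literal ℕ}
    {D : Clause ℕ} (h : D ∈ gadgetLiteralCNF a g l) : D.length = a := by
  obtain ⟨S, -, rfl⟩ := List.mem_map.1 h
  simp

/-- Every clause of the lift of a clause with `k` literals has exactly `ka` literals. [folklore] -/
theorem length_of_mem_gadgetLiftClause {a : ℕ} {g : (Fin a → Bool) → Bool} {c : Clause ℕ}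
    {D : Clause ℕ} (h : D ∈ gadgetLiftClause a g c) : D.length = c.length * a := by
  induction c generalizing D with
  | nil =>
    simp only [gadgetLiftClause, List.mem_singleton] at h
    simp [h]
  | cons l c ih =>
    simp only [gadgetLiftClause, List.mem_flatMap, List.mem_map] at h
    obtain ⟨d, hd, e, he, rfl⟩ := h
    rw [List.length_append, length_of_mem_gadgetLiteralCNF hd, ih he, List.length_cons]
    ring

/-- **`F ∘ gⁿ` of a `k`-CNF is a `ka`-CNF.** [cite: GargEtAl2018, §2] -/
theorem isWidthLE_gadgetLift {k a : ℕ} {g : (Fin a → Bool) → Bool} {φ : CNF ℕ}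
    (h : φ.IsWidthLE k) : (gadgetLift a g φ).IsWidthLE (k * a) := by
  intro D hD
  obtain ⟨c, hc, hD⟩ := List.mem_flatMap.1 hD
  rw [length_of_mem_gadgetLiftClause hD]
  exact Nat.mul_le_mul_right a (h c hc)

/-- Every variable of the lift of a clause `c` is `x·a + j` for a variable `x` of `c` and `j < a`.
[folklore] -/
theorem exists_of_mem_gadgetLiftClause {a : ℕ} {g : (Fin a → Bool) → Bool} {c : Clause ℕ}
    {D : Clause ℕ} {m : Literal ℕ} (hD : D ∈ gadgetLiftClause a g c) (hm : m ∈ D) :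
    ∃ l ∈ c, ∃ j < a, m.1 = l.1 * a + j := by
  induction c generalizing D with
  | nil =>
    simp only [gadgetLiftClause, List.mem_singleton] at hD
    simp [hD] at hm
  | cons l c ih =>
    simp only [gadgetLiftClause, List.mem_flatMap, List.mem_map] at hD
    obtain ⟨d, hd, e, he, rfl⟩ := hD
    rcases List.mem_append.1 hm with hm | hm
    · obtain ⟨S, -, rfl⟩ := List.mem_map.1 hd
      obtain ⟨v, hv, rfl⟩ := List.mem_map.1 hm
      obtain ⟨j, hj, rfl⟩ := mem_xorBlock.1 hv
      exact ⟨l, List.mem_cons_self, j, hj, rfl⟩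
    · obtain ⟨l', hl', j, hj, h⟩ := ih he hm
      exact ⟨l', List.mem_cons_of_mem _ hl', j, hj, h⟩

/-- **`F ∘ gⁿ` of a CNF on `x₀,…,x_{n-1}` is a CNF on `a·n` variables**:
`numVars (gadgetLift a g φ) ≤ a * numVars φ`. [cite: GargEtAl2018, §2] -/
theorem numVars_gadgetLift_le (a : ℕ) (g : (Fin a → Bool) → Bool) (φ : CNF ℕ) :
    (gadgetLift a g φ).numVars ≤ a * φ.numVars := by
  refine numVars_le_iff.2 fun D hD m hm => ?_
  obtain ⟨c, hc, hD⟩ := List.mem_flatMap.1 hD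
  obtain ⟨l, hl, j, hj, hm⟩ := exists_of_mem_gadgetLiftClause hD hm
  have hx := fst_lt_numVars hc hl
  calc m.1 = l.1 * a + j := hm
    _ < l.1 * a + a := by omega
    _ = a * (l.1 + 1) := by ring
    _ ≤ a * φ.numVars := Nat.mul_le_mul_left a hx

/-- The lift of a clause with `k` literals has at most `(2^a)^k` clauses. [folklore] -/
theorem length_gadgetLiftClause_le (a : ℕ) (g : (Fin a → Bool) → Bool) (c : Clause ℕ) :
    (gadgetLiftClause a g c).length ≤ (2 ^ a) ^ c.length := by
  induction c with
  | nil => simp [gadgetLiftClause]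
  | cons l c ih =>
    rw [gadgetLiftClause, List.length_flatMap, List.length_cons, pow_succ, mul_comm]
    have hlit : (gadgetLiteralCNF a g l).length ≤ 2 ^ a := by
      unfold gadgetLiteralCNF
      rw [List.length_map]
      refine (List.length_filter_le _ _).trans ?_
      rw [List.length_sublists, length_xorBlock]
    calc ((gadgetLiteralCNF a g l).map fun d => ((gadgetLiftClause a g c).map fun e => d ++ e).length).sum
        ≤ ((gadgetLiteralCNF a g l).map fun _ => (2 ^ a) ^ c.length).sum :=
          List.sum_le_sum (fun d _ => by rw [List.length_map]; exact ih)
      _ = (gadgetLiteralCNF a g l).length * (2 ^ a) ^ c.length := by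
          rw [List.map_const', List.sum_replicate, smul_eq_mul]
      _ ≤ 2 ^ a * (2 ^ a) ^ c.length := Nat.mul_le_mul_right _ hlit

/-- **`F ∘ gⁿ` of a `k`-CNF with `m` clauses has at most `m · 2^{ak}` clauses.** [folklore] -/
theorem length_gadgetLift_le {k : ℕ} (a : ℕ) (g : (Fin a → Bool) → Bool) {φ : CNF ℕ}
    (h : φ.IsWidthLE k) : (gadgetLift a g φ).length ≤ φ.length * (2 ^ a) ^ k := by
  unfold gadgetLift
  rw [List.length_flatMap]
  calc (φ.map fun c => (gadgetLiftClause a g c).length).sum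
      ≤ (φ.map fun _ => (2 ^ a) ^ k).sum := List.sum_le_sum fun c hc =>
          (length_gadgetLiftClause_le a g c).trans
            (Nat.pow_le_pow_right (pow_pos two_pos a) (h c hc))
    _ = φ.length * (2 ^ a) ^ k := by rw [List.map_const', List.sum_replicate, smul_eq_mul]

/-! ### The inner-product gadget and the `IP`-lift -/

/-- **The inner-product gadget** on a block of `2ℓ` bits read as `ℓ` pairs:
`IP_ℓ(u) = ⊕_{j<ℓ} (u_{2j} ∧ u_{2j+1})`. [cite: KushilevitzNisan1996, Example 1.26]
[cite: RaoYehudayoff2020, Ch. 8] -/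
def ipGadget (ℓ : ℕ) (u : Fin (2 * ℓ) → Bool) : Bool :=
  decide (((Finset.univ : Finset (Fin ℓ)).filter fun j : Fin ℓ =>
    u ⟨2 * (j : ℕ), by have := j.isLt; omega⟩ &&
      u ⟨2 * (j : ℕ) + 1, by have := j.isLt; omega⟩).card % 2 = 1)

/-- **The `IP`-lift `F ∘ IP_ℓⁿ` of a CNF**: every variable `x` is replaced by the inner product
mod 2 of the two halves of a block of `2ℓ` fresh variables `x·2ℓ, …, x·2ℓ + 2ℓ - 1` (pairs
`(x·2ℓ + 2j, x·2ℓ + 2j + 1)`), expanded into CNF. [cite: GargEtAl2018, §2] [cite: RaoYehudayoff2020, Ch. 8] -/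
def ipLift (ℓ : ℕ) (φ : CNF ℕ) : CNF ℕ :=
  gadgetLift (2 * ℓ) (ipGadget ℓ) φ

/-- The `IP`-lift preserves unsatisfiability. [cite: GargEtAl2018, §2] -/
theorem ipLift_not_satisfiable {ℓ : ℕ} {φ : CNF ℕ} (h : ¬ φ.Satisfiable) :
    ¬ (ipLift ℓ φ).Satisfiable :=
  gadgetLift_not_satisfiable h

/-- The `IP_ℓ`-lift of a `k`-CNF is a `2kℓ`-CNF. [cite: GargEtAl2018, §2] -/
theorem isWidthLE_ipLift {k ℓ : ℕ} {φ : CNF ℕ} (h : φ.IsWidthLE k) :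
    (ipLift ℓ φ).IsWidthLE (k * (2 * ℓ)) :=
  isWidthLE_gadgetLift h

/-- The `IP_ℓ`-lift of a CNF on `n` variables has at most `2ℓn` variables. [cite: GargEtAl2018, §2] -/
theorem numVars_ipLift_le (ℓ : ℕ) (φ : CNF ℕ) : (ipLift ℓ φ).numVars ≤ 2 * ℓ * φ.numVars :=
  numVars_gadgetLift_le _ _ φ

/-- The `IP_ℓ`-lift of a `k`-CNF with `m` clauses has at most `m · 4^{kℓ}` clauses. [folklore] -/
theorem length_ipLift_le {k : ℕ} (ℓ : ℕ) {φ : CNF ℕ} (h : φ.IsWidthLE k) :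
    (ipLift ℓ φ).length ≤ φ.length * (2 ^ (2 * ℓ)) ^ k :=
  length_gadgetLift_le _ _ h

end Literature.Computability.MetaComplexity
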